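import Mathlib
import HarnessLib
import Literature.Analysis.FluidPDE.SereginSverakPressureLocalTypeI
import Literature.Analysis.FluidPDE.BlowupFarField
import Summits.NavierStokesRegularity.NavierStokesRegularity.Theorems.TypeIQuarterGateScarZoomDefs
import Summits.NavierStokesRegularity.NavierStokesRegularity.Theorems.TypeIQuarterGateSliceBudgetDefs
import Summits.NavierStokesRegularity.NavierStokesRegularity.Theorems.TypeIQuarterGateScarEnvelopeTypeIBudgetZoomLimit
import Summits.NavierStokesRegularity.NavierStokesRegularity.Theorems.TypeIQuarterGateScarEnvelopeTypeIScarZoom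
import Summits.NavierStokesRegularity.NavierStokesRegularity.Theorems.TypeIQuarterGateScarEnvelopeTypeIBudgetViolators
import Summits.NavierStokesRegularity.NavierStokesRegularity.Theorems.TypeICertificateLadderNoTypeIBlowupTypeIMorrey

/-!
# Crux `TypeIQuarterGate.ScarEnvelopeTypeI` (stmt-NavierStokesRegularity-23843), line `slice_budget` —
# scar violators zoom to a twin-scar object IN THE FULL ALBRITTON–BARKER CLASS (all five conjuncts),
# and a failure of SD does so too

Helper file (no new definitions).  `exists_ABClassTwinScar_of_scarViolators` is g3's landed
`exists_twinScarObject_inBall` (p617310; Steps (1)–(6) copied verbatim: Morrey zoom about the scar,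
genuine singularity, rate window, violator scales and satellites, the budget-free twin zoom
`exists_typeIAncientMild_twinZoomLimit_budget` with `q = ⊤`) with ONE change in the packaging: ALL FIVE
conjuncts of the zoom theorem's output are kept — KNSS-gauge Type-I ancient mild, suitable weak in every
backward ball at the top vertex, suitable weak on the open past slab, a weak gradient there, and
`𝐈((−∞,0) × ℝ³) < ⊤` (the class `ABClass` of line `slice_budget` v7) — together with the two backward
singular points `(0,0)` and `(0,e)`, `‖e‖ = 1`.  The Morrey bound `𝐈 < ⊤` is what the top-time CKN
tool (`…TopTimeCKN.lean`) consumes; `exists_twinScarObject_inBall` had discarded it.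

* `exists_ABClassTwinScar_of_scarViolators` — `CruxHypotheses → ScarViolators →` an A–B-class (five
  conjuncts) object singular at `(0,0)` and at `(0,e)`, `‖e‖ = 1`;
* `exists_ABClassTwinScar_of_not_octaveBudget` — the same from `¬ OctaveBudget`
  (`scarViolators_of_not_octaveBudget`, file `…BudgetViolators.lean`);
* `octaveBudget_of_noABClassTwinScar'` — contrapositive: the ISOLATED-SCAR statement «an A–B-class object
  singular at the origin at the final time has no final-time singular point on the unit sphere» implies SD
  (the form `W` of line `slice_budget` v8, here with `ABClass` / `finalSingularSet` spelled out).

HONEST FRAMING: bookkeeping; SD, the crux `ScarEnvelopeTypeI`, its parent and the summit are OPEN and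
nothing here is credited toward them.
-/

noncomputable section

-- the summit-side namespace `Summit.NavierStokesRegularity.NavierStokesRegularity.…` (single-conjunct
-- summit, D-0017) repeats a component by design; the dupNamespace linter would flag every declaration.
set_option linter.dupNamespace false

namespace Summit.NavierStokesRegularity.NavierStokesRegularity.Cruxes.ScarEnvelopeTypeI.SliceBudget

open MeasureTheory Set Function Filter Topology TopologicalSpace Metric
open scoped NNReal ENNReal
open Literature.Analysis Literature.Analysis.FluidPDE
open Summit.NavierStokesRegularity.NavierStokesRegularity.Cruxes.ScarEnvelopeTypeI.ScarZoom

/-- **Scar violators zoom to a twin-scar object in the full Albritton–Barker class.**  Under the crux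
hypotheses, a scar-violator sequence produces `M, U, P, H` with: `IsTypeIAncientMild M U`; `U, P`
suitable weak in every backward ball `Q_{R'}(0,0)`; suitable weak on the open past slab with weak
gradient `H`; `𝐈((−∞,0) × ℝ³) < ⊤`; and backward singular points at `(0,0)` and at `(0,e)` for some
`‖e‖ = 1`.  (g3's `exists_twinScarObject_inBall`, all output conjuncts kept.) -/
theorem exists_ABClassTwinScar_of_scarViolators :
    ∀ (ν T : ℝ) (u : ℝ → (EuclideanSpace ℝ (Fin 3)) → (EuclideanSpace ℝ (Fin 3)))
      (p : ℝ → (EuclideanSpace ℝ (Fin 3)) → ℝ),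
      CruxHypotheses ν T u p → ScarViolators T u →
        ∃ (M : ℝ) (U : ℝ → (EuclideanSpace ℝ (Fin 3)) → (EuclideanSpace ℝ (Fin 3)))
          (P : ℝ → (EuclideanSpace ℝ (Fin 3)) → ℝ)
          (H : ℝ → (EuclideanSpace ℝ (Fin 3)) → (EuclideanSpace ℝ (Fin 3)) →L[ℝ] (EuclideanSpace ℝ (Fin 3))),
          IsTypeIAncientMild M U ∧
          (∀ R' : ℝ, 0 < R' →
            IsSuitableWeakSolutionInBall R' ((0 : ℝ), (0 : EuclideanSpace ℝ (Fin 3))) U P) ∧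
          IsSuitableWeakSolutionOn (slab (EuclideanSpace ℝ (Fin 3)) (Iio 0) isOpen_Iio) 1 0 U P ∧
          HasWeakSpatialGradientOn (slab (EuclideanSpace ℝ (Fin 3)) (Iio 0) isOpen_Iio) U H ∧
          typeIBound (Iio (0 : ℝ) ×ˢ univ) U P H < ⊤ ∧
          IsBackwardSingularPoint U ((0 : ℝ), (0 : EuclideanSpace ℝ (Fin 3))) ∧
          ∃ e : EuclideanSpace ℝ (Fin 3), ‖e‖ = 1 ∧ IsBackwardSingularPoint U ((0 : ℝ), e) := by
  intro ν T u p hH hV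
  obtain ⟨hν, hT, hmax, hLH, -, hTI, -⟩ := hH
  obtain ⟨a, x, t, ht, hxa, ht_tend, hx_tend, hratio, hprod⟩ := hV
  have hsol := hmax.1
  -- ## (1) Morrey bound and the viscosity-normalising zoom about the scar `(T, a)`
  obtain ⟨r₀, M₀, T₁, hr₀, hT₁, hMor⟩ :=
    Summit.NavierStokesRegularity.NavierStokesRegularity.Theorems.morrey_of_typeI hν hT hsol hLH hTI
  obtain ⟨R, α, β, hR, hα, hβ, -, -, hβT, hball, hGv, htypeI⟩ :=
    Summit.NavierStokesRegularity.NavierStokesRegularity.Theorems.exists_zoom_typeIBound_lt_top_of_morrey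
      hν hT hsol hLH hr₀ hT₁ hMor a
  set q : ℝ → (EuclideanSpace ℝ (Fin 3)) → ℝ := fun t x => p t x - (p t 0 - normalisedPressure (u t) 0) with hq
  set v : ℝ → (EuclideanSpace ℝ (Fin 3)) → (EuclideanSpace ℝ (Fin 3)) := α • stPull β R T a u with hv
  set πv : ℝ → (EuclideanSpace ℝ (Fin 3)) → ℝ := α ^ 2 • stPull β R T a q with hπv
  set Gv : ℝ → (EuclideanSpace ℝ (Fin 3)) → (EuclideanSpace ℝ (Fin 3)) →L[ℝ] (EuclideanSpace ℝ (Fin 3)) := (α * R) • stPull β R T a (fun t x => fderiv ℝ (u t) x)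
    with hGvdef
  -- ## (2) the scar is a genuine singular point
  have hnorm : Tendsto (fun k => ‖u (t k) (x k)‖) atTop atTop := by
    have hdist : Tendsto (fun k => ‖x k - a‖) atTop (𝓝 0) :=
      tendsto_iff_norm_sub_tendsto_zero.1 hx_tend
    have hsmall : ∀ᶠ k in atTop, ‖x k - a‖ ≤ 1 :=
      hdist.eventually (Iic_mem_nhds one_pos)
    refine tendsto_atTop_mono' atTop ?_ hprod
    filter_upwards [hsmall] with k hk
    calc ‖x k - a‖ * ‖u (t k) (x k)‖ ≤ 1 * ‖u (t k) (x k)‖ :=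
        mul_le_mul_of_nonneg_right hk (norm_nonneg _)
      _ = ‖u (t k) (x k)‖ := one_mul _
  have hnotbd : ¬ IsBackwardBoundedAt u T a := by
    rintro ⟨r, hr, K, hK⟩
    have h1 : ∀ᶠ k in atTop, T - r ^ 2 < t k := ht_tend.eventually (lt_mem_nhds (by nlinarith))
    have h2 : ∀ᶠ k in atTop, x k ∈ ball a r := hx_tend.eventually_mem (ball_mem_nhds a hr)
    have h3 : ∀ᶠ k in atTop, K < ‖u (t k) (x k)‖ := hnorm.eventually (eventually_gt_atTop K)
    obtain ⟨k, hk1, hk2, hk3⟩ := (h1.and (h2.and h3)).exists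
    exact absurd (hK (t k) ⟨hk1, (ht k).2⟩ (x k) hk2) (not_le.2 hk3)
  have hsing : IsBackwardSingularPoint v (0 : ℝ × (EuclideanSpace ℝ (Fin 3))) := by
    intro r hr
    by_contra hfin
    have hfin' : eLpNorm (uncurry v) ⊤
        (volume.restrict (parabolicCylinder (min r 1) (0 : ℝ × (EuclideanSpace ℝ (Fin 3))))) < ⊤ := by
      refine lt_of_le_of_lt (eLpNorm_mono_measure _ (Measure.restrict_mono ?_ le_rfl))
        (lt_top_iff_ne_top.2 hfin)
      exact parabolicCylinder_mono (le_min hr.le zero_le_one) (min_le_left _ _) _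
    exact hnotbd (SereginSverak2002.isBackwardBoundedAt_of_zoom hsol a hR hα hβ hβT
      (lt_min hr one_pos) (min_le_right _ _) hfin')
  -- ## (3) the trivial budget (`q = ⊤`): the budget-carrying twin zoom is used only for its
  -- Albritton–Barker-class output
  have hbudv : ∀ t' ∈ Ioo ((0 : ℝ × (EuclideanSpace ℝ (Fin 3))).1 - 1) (0 : ℝ × (EuclideanSpace ℝ (Fin 3))).1, ∀ ℓ' : ℝ,
      Real.sqrt ((0 : ℝ × (EuclideanSpace ℝ (Fin 3))).1 - t') ≤ ℓ' → ℓ' ≤ 1 →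
      ∫⁻ y in {y : (EuclideanSpace ℝ (Fin 3)) | ℓ' < ‖y - (0 : ℝ × (EuclideanSpace ℝ (Fin 3))).2‖ ∧ ‖y - (0 : ℝ × (EuclideanSpace ℝ (Fin 3))).2‖ < Real.exp 1 * ℓ'},
        ‖v t' y‖ₑ ^ (3 : ℝ) ≤ (⊤ : ℝ≥0∞) := fun _ _ _ _ _ => le_top
  -- ## (4) the rate of the zoom on a final window and the data on `Q(0, ρ')`
  obtain ⟨C, δ, hC0, hδ, -, hrate⟩ :=
    Summit.NavierStokesRegularity.NavierStokesRegularity.Theorems.exists_typeI_rate_window hT hTI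
  set C₁ : ℝ := α * C / Real.sqrt β with hC₁def
  have hratev : ∀ s ∈ Ioo (-(δ / β)) 0, ∀ y, ‖v s y‖ ≤ C₁ / Real.sqrt (-s) := by
    intro s hs y
    have h1 : -δ < β * s := by
      have h := mul_lt_mul_of_pos_left hs.1 hβ
      rwa [mul_neg, mul_div_cancel₀ _ hβ.ne'] at h
    have h2 : β * s < 0 := mul_neg_of_pos_of_neg hβ hs.2
    have hb := hrate (T + β * s) ⟨by linarith, by linarith⟩ (a + R • y)
    have hsq : Real.sqrt (T - (T + β * s)) = Real.sqrt β * Real.sqrt (-s) := by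
      rw [show T - (T + β * s) = β * (-s) by ring, Real.sqrt_mul hβ.le]
    rw [hsq] at hb
    have hpos : 0 < Real.sqrt (-s) := Real.sqrt_pos.2 (by linarith [hs.2])
    have hposβ : 0 < Real.sqrt β := Real.sqrt_pos.2 hβ
    rw [hv, smul_stPull_apply, norm_smul, Real.norm_of_nonneg hα.le, hC₁def]
    rw [div_div, le_div_iff₀ (by positivity)]
    calc α * ‖u (T + β * s) (a + R • y)‖ * (Real.sqrt β * Real.sqrt (-s))
        = α * (Real.sqrt β * Real.sqrt (-s) * ‖u (T + β * s) (a + R • y)‖) := by ring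
      _ ≤ α * C := mul_le_mul_of_nonneg_left hb hα.le
  set ρ' : ℝ := min (1 / 2) (Real.sqrt (δ / β)) with hρ'def
  have hρ' : 0 < ρ' := lt_min (by norm_num) (Real.sqrt_pos.2 (div_pos hδ hβ))
  have hρ'half : ρ' ≤ 1 / 2 := min_le_left _ _
  have hρ'1 : ρ' ≤ 1 := hρ'half.trans (by norm_num)
  have hρ'sq : ρ' ^ 2 ≤ δ / β := by
    have h1 : ρ' ≤ Real.sqrt (δ / β) := min_le_right _ _
    have := pow_le_pow_left₀ hρ'.le h1 2
    rwa [Real.sq_sqrt (div_pos hδ hβ).le] at this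
  have hsub1 : parabolicCylinder ρ' (0 : ℝ × (EuclideanSpace ℝ (Fin 3))) ⊆ parabolicCylinder 1 (0 : ℝ × (EuclideanSpace ℝ (Fin 3))) :=
    parabolicCylinder_mono hρ'.le hρ'1 _
  have hsubh : parabolicCylinder ρ' (0 : ℝ × (EuclideanSpace ℝ (Fin 3))) ⊆ parabolicCylinder (1 / 2) (0 : ℝ × (EuclideanSpace ℝ (Fin 3))) :=
    parabolicCylinder_mono hρ'.le hρ'half _
  have hball' : IsSuitableWeakSolutionInBall ρ' 0 v πv := hball.of_subset_zero hρ' hsub1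
  have hGv' : HasWeakSpatialGradientOn (parabolicCylinderOpens ρ' (0 : ℝ × (EuclideanSpace ℝ (Fin 3)))) v Gv :=
    hGv.mono fun w hw => hsub1 hw
  have hI' : typeIBound (parabolicCylinder ρ' (0 : ℝ × (EuclideanSpace ℝ (Fin 3)))) v πv Gv < ⊤ :=
    lt_of_le_of_lt (typeIBound_mono hsubh) htypeI
  have hwin : ∀ w ∈ parabolicCylinder ρ' (0 : ℝ × (EuclideanSpace ℝ (Fin 3))), w.1 ∈ Ioo (-(δ / β)) 0 ∧
      T + β * w.1 ∈ Ico 0 T := by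
    intro w hw
    rw [mem_parabolicCylinder] at hw
    simp only [Prod.fst_zero, zero_sub] at hw
    obtain ⟨⟨h1, h2⟩, -⟩ := hw
    have h3 : -(δ / β) < w.1 := by linarith
    have hρ'sq1 : ρ' ^ 2 ≤ 1 := by nlinarith
    have h4 : β * ρ' ^ 2 ≤ β * 1 := mul_le_mul_of_nonneg_left hρ'sq1 hβ.le
    have h5 : β * (-ρ' ^ 2) < β * w.1 := mul_lt_mul_of_pos_left h1 hβ
    have h6 : β * w.1 < β * 0 := mul_lt_mul_of_pos_left h2 hβ
    refine ⟨⟨h3, h2⟩, ?_, by linarith⟩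
    linarith
  have hvc' : ContinuousOn (uncurry v) (parabolicCylinder ρ' (0 : ℝ × (EuclideanSpace ℝ (Fin 3)))) := by
    have hcontu : ContinuousOn (uncurry u) (Ico 0 T ×ˢ univ) := hsol.smooth_velocity.continuousOn
    have e : uncurry v = fun w => α • (uncurry u ∘ stAffine β R T a) w := by
      funext w
      rfl
    rw [e]
    refine ContinuousOn.const_smul (hcontu.comp (continuous_stAffine _ _ _ _).continuousOn ?_) α
    intro w hw
    rw [mem_prod, stAffine_fst]
    exact ⟨(hwin w hw).2, mem_univ _⟩
  have hrate' : ∀ (s : ℝ) (y : (EuclideanSpace ℝ (Fin 3))), (s, y) ∈ parabolicCylinder ρ' (0 : ℝ × (EuclideanSpace ℝ (Fin 3))) →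
      ‖v s y‖ ≤ C₁ / Real.sqrt ((0 : ℝ × (EuclideanSpace ℝ (Fin 3))).1 - s) := by
    intro s y hsy
    show ‖v s y‖ ≤ C₁ / Real.sqrt ((0 : ℝ) - s)
    rw [zero_sub]
    exact hratev s (hwin _ hsy).1 y
  -- ## (5) scales, satellites and the values at the satellites
  have hρpos : ∀ k, 0 < ‖x k - a‖ := fun k => norm_pos_iff.2 (sub_ne_zero.2 (hxa k))
  set Rz : ℕ → ℝ := fun k => ‖x k - a‖ / R with hRz
  have hRz_pos : ∀ k, 0 < Rz k := fun k => div_pos (hρpos k) hR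
  have hRz0 : Tendsto Rz atTop (𝓝 0) := by
    have h := (tendsto_iff_norm_sub_tendsto_zero.1 hx_tend).div_const R
    rwa [zero_div] at h
  set sN : ℕ → ℝ := fun k => (t k - T) / (β * Rz k ^ 2) with hsN
  have hsN_neg : ∀ k, sN k < 0 := fun k =>
    div_neg_of_neg_of_pos (by linarith [(ht k).2]) (mul_pos hβ (pow_pos (hRz_pos k) 2))
  have hsN0 : Tendsto sN atTop (𝓝 0) := by
    have e : ∀ k, sN k = -(R ^ 2 / β) * ((T - t k) / ‖x k - a‖ ^ 2) := by
      intro k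
      have h1 : ‖x k - a‖ ≠ 0 := (hρpos k).ne'
      simp only [hsN, hRz]
      field_simp
      ring
    rw [show sN = fun k => -(R ^ 2 / β) * ((T - t k) / ‖x k - a‖ ^ 2) from funext e]
    simpa using hratio.const_mul (-(R ^ 2 / β))
  set ηN : ℕ → (EuclideanSpace ℝ (Fin 3)) := fun k => ‖x k - a‖⁻¹ • (x k - a) with hηN
  have hηN_mem : ∀ k, ηN k ∈ sphere (0 : (EuclideanSpace ℝ (Fin 3))) 1 := by
    intro k
    rw [mem_sphere_zero_iff_norm, hηN]
    dsimp only
    rw [norm_smul, norm_inv, norm_norm, inv_mul_cancel₀ (hρpos k).ne']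
  obtain ⟨e, he, ψ, hψ, hηe⟩ := (isCompact_sphere (0 : (EuclideanSpace ℝ (Fin 3))) 1).tendsto_subseq hηN_mem
  have he1 : ‖e‖ = 1 := mem_sphere_zero_iff_norm.1 he
  have harg1 : ∀ k, T + β * (Rz k ^ 2 * sN k) = t k := by
    intro k
    have h1 : Rz k ≠ 0 := (hRz_pos k).ne'
    simp only [hsN]
    field_simp
    ring
  have harg2 : ∀ k, a + R • (Rz k • ηN k) = x k := by
    intro k
    have h1 : ‖x k - a‖ ≠ 0 := (hρpos k).ne'
    simp only [hRz, hηN, smul_smul]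
    rw [show R * (‖x k - a‖ / R * ‖x k - a‖⁻¹) = 1 by field_simp, one_smul, add_sub_cancel]
  have hval : ∀ k, Rz k * ‖v ((0 : ℝ × (EuclideanSpace ℝ (Fin 3))).1 + Rz k ^ 2 * sN k) ((0 : ℝ × (EuclideanSpace ℝ (Fin 3))).2 + Rz k • ηN k)‖ =
      (α / R) * (‖x k - a‖ * ‖u (t k) (x k)‖) := by
    intro k
    rw [Prod.fst_zero, Prod.snd_zero, zero_add, zero_add, hv, smul_stPull_apply, harg1, harg2,
      norm_smul, Real.norm_of_nonneg hα.le, hRz]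
    ring
  have hsat : Tendsto (fun n => Rz (ψ n) *
      ‖v ((0 : ℝ × (EuclideanSpace ℝ (Fin 3))).1 + Rz (ψ n) ^ 2 * sN (ψ n)) ((0 : ℝ × (EuclideanSpace ℝ (Fin 3))).2 + Rz (ψ n) • ηN (ψ n))‖)
      atTop atTop := by
    simp only [hval]
    exact (hprod.comp hψ.tendsto_atTop).const_mul_atTop (div_pos hα hR)
  -- ## (6) the twin zoom limit carrying the budget
  obtain ⟨U, P, H, hTI', hInBall, hswU, hHU, hIU, hsing0, hsinge, -⟩ :=
    exists_typeIAncientMild_twinZoomLimit_budget (z₀ := (0 : ℝ × (EuclideanSpace ℝ (Fin 3)))) (M := C₁) hρ' hball' hGv'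
      hI' hvc' hrate' hsing one_pos one_pos hbudv
      (R := fun n => Rz (ψ n)) (fun n => hRz_pos (ψ n)) (hRz0.comp hψ.tendsto_atTop)
      (s := fun n => sN (ψ n)) (η := fun n => ηN (ψ n)) (e := e) he1 (fun n => hsN_neg (ψ n))
      (hsN0.comp hψ.tendsto_atTop) hηe hsat
  -- ## (7) packaging: all five class conjuncts and the two singular points
  exact ⟨C₁, U, P, H, hTI', hInBall, hswU, hHU, hIU, hsing0, e, he1, hsinge⟩

/-- **¬SD ⟹ a twin-scar object in the full A–B class** (`scarViolators_of_not_octaveBudget` +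
`exists_ABClassTwinScar_of_scarViolators`). -/
theorem exists_ABClassTwinScar_of_not_octaveBudget {ν T : ℝ}
    {u : ℝ → (EuclideanSpace ℝ (Fin 3)) → (EuclideanSpace ℝ (Fin 3))}
    {p : ℝ → (EuclideanSpace ℝ (Fin 3)) → ℝ}
    (hH : CruxHypotheses ν T u p) (hnot : ¬ OctaveBudget ν T u) :
    ∃ (M : ℝ) (U : ℝ → (EuclideanSpace ℝ (Fin 3)) → (EuclideanSpace ℝ (Fin 3)))
      (P : ℝ → (EuclideanSpace ℝ (Fin 3)) → ℝ)
      (H : ℝ → (EuclideanSpace ℝ (Fin 3)) → (EuclideanSpace ℝ (Fin 3)) →L[ℝ] (EuclideanSpace ℝ (Fin 3))),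
      IsTypeIAncientMild M U ∧
      (∀ R' : ℝ, 0 < R' →
        IsSuitableWeakSolutionInBall R' ((0 : ℝ), (0 : EuclideanSpace ℝ (Fin 3))) U P) ∧
      IsSuitableWeakSolutionOn (slab (EuclideanSpace ℝ (Fin 3)) (Iio 0) isOpen_Iio) 1 0 U P ∧
      HasWeakSpatialGradientOn (slab (EuclideanSpace ℝ (Fin 3)) (Iio 0) isOpen_Iio) U H ∧
      typeIBound (Iio (0 : ℝ) ×ˢ univ) U P H < ⊤ ∧
      IsBackwardSingularPoint U ((0 : ℝ), (0 : EuclideanSpace ℝ (Fin 3))) ∧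
      ∃ e : EuclideanSpace ℝ (Fin 3), ‖e‖ = 1 ∧ IsBackwardSingularPoint U ((0 : ℝ), e) :=
  exists_ABClassTwinScar_of_scarViolators ν T u p hH (scarViolators_of_not_octaveBudget hH hnot)

/-- **The isolated-scar Liouville statement implies SD** (spelled-out form of v8's `W → SD`): if every
object of the full A–B class that is backward singular at `(0,0)` has NO backward singular point `(0,e)`
with `‖e‖ = 1`, then the slice-wise octave budget holds for every crux-class blow-up. -/
theorem octaveBudget_of_noABClassTwinScar'
    (hW : ∀ (M : ℝ) (U : ℝ → (EuclideanSpace ℝ (Fin 3)) → (EuclideanSpace ℝ (Fin 3)))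
      (P : ℝ → (EuclideanSpace ℝ (Fin 3)) → ℝ)
      (H : ℝ → (EuclideanSpace ℝ (Fin 3)) → (EuclideanSpace ℝ (Fin 3)) →L[ℝ] (EuclideanSpace ℝ (Fin 3))),
      (IsTypeIAncientMild M U ∧
        (∀ R' : ℝ, 0 < R' →
          IsSuitableWeakSolutionInBall R' ((0 : ℝ), (0 : EuclideanSpace ℝ (Fin 3))) U P) ∧
        IsSuitableWeakSolutionOn (slab (EuclideanSpace ℝ (Fin 3)) (Iio 0) isOpen_Iio) 1 0 U P ∧
        HasWeakSpatialGradientOn (slab (EuclideanSpace ℝ (Fin 3)) (Iio 0) isOpen_Iio) U H ∧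
        typeIBound (Iio (0 : ℝ) ×ˢ univ) U P H < ⊤) →
      IsBackwardSingularPoint U ((0 : ℝ), (0 : EuclideanSpace ℝ (Fin 3))) →
      ∀ e : EuclideanSpace ℝ (Fin 3), ‖e‖ = 1 → ¬ IsBackwardSingularPoint U ((0 : ℝ), e))
    {ν T : ℝ} {u : ℝ → (EuclideanSpace ℝ (Fin 3)) → (EuclideanSpace ℝ (Fin 3))}
    {p : ℝ → (EuclideanSpace ℝ (Fin 3)) → ℝ} (hH : CruxHypotheses ν T u p) :
    OctaveBudget ν T u := by
  by_contra hnot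
  obtain ⟨M, U, P, H, h1, h2, h3, h4, h5, h0, e, he, hse⟩ := exists_ABClassTwinScar_of_not_octaveBudget hH hnot
  exact hW M U P H ⟨h1, h2, h3, h4, h5⟩ h0 e he hse

end Summit.NavierStokesRegularity.NavierStokesRegularity.Cruxes.ScarEnvelopeTypeI.SliceBudget

end
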